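import Summits.ResolutionOfSingularities.ResolutionOfSingularities.Theorems.FrobeniusLadderFInjectiveMacaulayficationFullLastCentreFibre
import HarnessLib

/-!
# K10m-a — TRIANGULAR SUBSTITUTIONS `ψ = tri s a b : y_s ↦ a·y_s + b`: injectivity (left inverse into the fraction field), no lowering of orders for substitutions without
# constant terms (`MinDeg`), and «`y_n ∣ ψ(G) ⇒ y_n ∣ G`» for a fixed letter `y_n` — the toolkit of the unit-triangular step K10m-b
# (crux `FInjectiveMacaulayfication` stmt-ResolutionOfSingularities-15315, chain w45a; desk R26.49 scoping order / tri-2 BAKEOFF rev 2.1 §F-Q; seat res-L1-w45a-lead-1 g16)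

[OURS · L1 W4.5a] Support file (`--supports stmt-ResolutionOfSingularities-15315 --as helper`); replaces the role of NO printed item; NOT a statement of any manuscript;
proves nothing of the crux; OURS counted 0. AI-written (AI review is weaker than expert review).

CONTENT. `tri s a b := aeval (y_s ↦ a·y_s + b, y_m ↦ y_m)`; ★ `tri_injective` (`a ≠ 0`, `a, b` free of `y_s`: `y_s ↦ (y_s − b)/a` into `Frac k[y]` is a left inverse);
`MinDeg G d` (`G ∈ 𝔪^d`) with its algebra; ★ `minDeg_aeval` / `ordLE_of_ordLE_aeval` (a substitution whose letters have no constant term maps `𝔪^d` into `𝔪^d`, so it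
does not LOWER orders); `ordLE_of_mul`; `X_dvd_of_no_free`, `not_X_dvd_of_free`; ★ `X_dvd_of_X_dvd_tri` (`n ≠ s`, `a(0) ≠ 0`: `y_n ∣ tri s a b G ⇒ y_n ∣ G`, by killing `y_n` — `keep_tri` — and
injectivity of the killed substitution). Exponent/coefficient bookkeeping only; no named fact.
-/

-- single-problem summit: the doubled namespace component is forced
set_option linter.dupNamespace false

noncomputable section

open MvPolynomial Finsupp
open Summit.ResolutionOfSingularities.ResolutionOfSingularities.Theorems.FInjectiveMacaulayfication.LastCentreDefs
open Summit.ResolutionOfSingularities.ResolutionOfSingularities.Theorems.FInjectiveMacaulayfication.LastCentreAxisOrder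
open Summit.ResolutionOfSingularities.ResolutionOfSingularities.Theorems.FInjectiveMacaulayfication.LastCentreSlack
open Summit.ResolutionOfSingularities.ResolutionOfSingularities.Theorems.FInjectiveMacaulayfication.LastCentreTame
open Summit.ResolutionOfSingularities.ResolutionOfSingularities.Theorems.FInjectiveMacaulayfication.LastCentreTranslate
open Summit.ResolutionOfSingularities.ResolutionOfSingularities.Theorems.FInjectiveMacaulayfication.LastCentreEquiChain
open Summit.ResolutionOfSingularities.ResolutionOfSingularities.Theorems.FInjectiveMacaulayfication.LastCentreFibre

namespace Summit.ResolutionOfSingularities.ResolutionOfSingularities.Theorems.FInjectiveMacaulayfication.LastCentreTriSubst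

variable {k : Type} [Field k]

/-! ## 1. The triangular substitution `ψ = tri s a b : y_s ↦ a·y_s + b` -/

/-- THE TRIANGULAR SUBSTITUTION `y_s ↦ a·y_s + b`, all other letters fixed. [OURS · L1 W4.5a · definition; folklore] -/
def tri (s : Letter) (a b : YPoly k) : YPoly k →ₐ[k] YPoly k :=
  aeval fun m => if m = s then a * X s + b else X m

/-- `tri` on the distinguished letter. [plumbing] -/
theorem tri_X_self (s : Letter) (a b : YPoly k) : tri s a b (X s) = a * X s + b := by
  unfold tri; rw [aeval_X, if_pos rfl]

/-- `tri` fixes the other letters. [plumbing] -/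
theorem tri_X_ne (s : Letter) (a b : YPoly k) {m : Letter} (hm : m ≠ s) : tri s a b (X m) = X m := by
  unfold tri; rw [aeval_X, if_neg hm]

/-- `tri` fixes constants. [plumbing] -/
theorem tri_C (s : Letter) (a b : YPoly k) (r : k) : tri s a b (C r) = C r := by
  unfold tri; rw [aeval_C, algebraMap_eq]

/-- `tri` fixes every polynomial not involving `y_s`. [plumbing] -/
theorem tri_eq_self_of_notMem_vars (s : Letter) (a b : YPoly k) {G : YPoly k} (h : s ∉ G.vars) : tri s a b G = G := by
  have := hom_congr_vars (f₁ := (tri s a b).toRingHom) (f₂ := RingHom.id (YPoly k)) (p₁ := G) (p₂ := G)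
    (RingHom.ext fun r => by show tri s a b (C r) = C r; exact tri_C s a b r)
    (fun i hi _ => by
      have his : i ≠ s := fun h' => h (h' ▸ hi)
      show tri s a b (X i) = X i
      exact tri_X_ne s a b his) rfl
  exact this

/-- ★ A TRIANGULAR SUBSTITUTION WITH NON-ZERO `y_s`-COEFFICIENT IS INJECTIVE: `y_s ↦ (y_s − b)/a` into the fraction field is a left inverse. [OURS · L1 W4.5a; folklore] -/
theorem tri_injective (s : Letter) {a b : YPoly k} (ha : a ≠ 0) (hav : s ∉ a.vars) (hbv : s ∉ b.vars) :
    Function.Injective (tri (k := k) s a b) := by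
  classical
  let K := FractionRing (YPoly k)
  let ι : YPoly k →+* K := algebraMap (YPoly k) K
  have hι : Function.Injective ι := IsFractionRing.injective (YPoly k) K
  have hιa : ι a ≠ 0 := fun h0 => ha (hι (by rw [h0, map_zero]))
  let v : Letter → K := fun m => if m = s then (ι (X s) - ι b) / ι a else ι (X m)
  let θ : YPoly k →+* K := eval₂Hom (ι.comp C) v
  have hθC : θ.comp C = ι.comp C := RingHom.ext fun r => by
    show eval₂Hom (ι.comp C) v (C r) = ι (C r); rw [eval₂Hom_C, RingHom.comp_apply]
  have hθX : ∀ m, m ≠ s → θ (X m) = ι (X m) := fun m hm => by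
    show eval₂Hom (ι.comp C) v (X m) = ι (X m); rw [eval₂Hom_X']; exact if_neg hm
  have hθfree : ∀ G : YPoly k, s ∉ G.vars → θ G = ι G := fun G hG =>
    hom_congr_vars hθC (fun i hi _ => hθX i fun h' => hG (h' ▸ hi)) rfl
  have hcomp : θ.comp (tri s a b).toRingHom = ι := by
    apply ringHom_ext
    · intro r
      show θ (tri s a b (C r)) = ι (C r)
      rw [tri_C]; exact RingHom.congr_fun hθC r
    · intro m
      show θ (tri s a b (X m)) = ι (X m)
      by_cases hm : m = s
      · subst hm
        rw [tri_X_self, map_add, map_mul, hθfree a hav, hθfree b hbv]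
        show ι a * eval₂Hom (ι.comp C) v (X m) + ι b = ι (X m)
        rw [eval₂Hom_X']
        show ι a * (if m = m then (ι (X m) - ι b) / ι a else ι (X m)) + ι b = ι (X m)
        rw [if_pos rfl, mul_div_cancel₀ _ hιa, sub_add_cancel]
      · rw [tri_X_ne s a b hm, hθX m hm]
  intro G H hGH
  apply hι
  have := congrArg θ hGH
  have hG := RingHom.congr_fun hcomp G
  have hH := RingHom.congr_fun hcomp H
  simp only [RingHom.comp_apply, AlgHom.toRingHom_eq_coe, RingHom.coe_coe] at hG hH
  rw [← hG, ← hH]; exact this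

/-! ## 2. Substitutions without constant terms do not lower orders -/

/-- `MinDeg G d`: every monomial of `G` has total degree `≥ d` (`G ∈ 𝔪^d`). [OURS · L1 W4.5a · definition] -/
def MinDeg (G : YPoly k) (d : ℕ) : Prop := ∀ e ∈ G.support, d ≤ tdeg e

/-- [plumbing] -/
theorem minDeg_add {A B : YPoly k} {d : ℕ} (hA : MinDeg A d) (hB : MinDeg B d) : MinDeg (A + B) d := by
  classical
  intro e he
  rcases Finset.mem_union.mp (MvPolynomial.support_add he) with h | h
  · exact hA e h
  · exact hB e h

/-- [plumbing] -/
theorem minDeg_sum {ι : Type} (T : Finset ι) (f : ι → YPoly k) {d : ℕ} (h : ∀ i ∈ T, MinDeg (f i) d) : MinDeg (∑ i ∈ T, f i) d := by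
  classical
  induction T using Finset.induction_on with
  | empty => intro e he; rw [Finset.sum_empty, MvPolynomial.support_zero] at he; exact absurd he (Finset.notMem_empty e)
  | insert i T hi ih =>
    rw [Finset.sum_insert hi]
    exact minDeg_add (h i (Finset.mem_insert_self i T)) (ih fun j hj => h j (Finset.mem_insert_of_mem hj))

/-- [plumbing] -/
theorem minDeg_mul {A B : YPoly k} {a b : ℕ} (hA : MinDeg A a) (hB : MinDeg B b) : MinDeg (A * B) (a + b) := by
  classical
  intro e he
  obtain ⟨e₁, he₁, e₂, he₂, rfl⟩ := Finset.mem_add.mp (support_mul A B he)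
  rw [tdeg_add]; exact Nat.add_le_add (hA e₁ he₁) (hB e₂ he₂)

/-- [plumbing] -/
theorem minDeg_one_zero : MinDeg (1 : YPoly k) 0 := fun _ _ => Nat.zero_le _

/-- [plumbing] -/
theorem minDeg_prod {ι : Type} (T : Finset ι) (f : ι → YPoly k) (g : ι → ℕ) (h : ∀ i ∈ T, MinDeg (f i) (g i)) :
    MinDeg (∏ i ∈ T, f i) (∑ i ∈ T, g i) := by
  classical
  induction T using Finset.induction_on with
  | empty => rw [Finset.prod_empty, Finset.sum_empty]; exact minDeg_one_zero
  | insert i T hi ih =>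
    rw [Finset.prod_insert hi, Finset.sum_insert hi]
    exact minDeg_mul (h i (Finset.mem_insert_self i T)) (ih fun j hj => h j (Finset.mem_insert_of_mem hj))

/-- [plumbing] -/
theorem minDeg_pow {A : YPoly k} {a : ℕ} (hA : MinDeg A a) (n : ℕ) : MinDeg (A ^ n) (n * a) := by
  induction n with
  | zero => rw [pow_zero, Nat.zero_mul]; exact minDeg_one_zero
  | succ n ih => rw [pow_succ, Nat.succ_mul]; exact minDeg_mul ih hA

/-- [plumbing] -/
theorem minDeg_C_mul {A : YPoly k} {d : ℕ} (hA : MinDeg A d) (r : k) : MinDeg (C r * A) d := by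
  classical
  intro e he
  rw [MvPolynomial.mem_support_iff, coeff_C_mul] at he
  exact hA e (MvPolynomial.mem_support_iff.mpr (right_ne_zero_of_mul he))

/-- [plumbing] -/
theorem minDeg_mono {A : YPoly k} {d d' : ℕ} (hA : MinDeg A d) (h : d' ≤ d) : MinDeg A d' := fun e he => h.trans (hA e he)

/-- A polynomial without constant term lies in `𝔪`. [plumbing] -/
theorem minDeg_one_of_constantCoeff {P : YPoly k} (h : constantCoeff P = 0) : MinDeg P 1 := by
  intro e he
  by_contra hlt
  have h0 : e = 0 := eq_zero_of_tdeg_eq_zero (by omega)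
  subst h0
  rw [MvPolynomial.mem_support_iff, ← constantCoeff_eq, h] at he
  exact he rfl

/-- ★ A SUBSTITUTION WITHOUT CONSTANT TERMS MAPS `𝔪^d` INTO `𝔪^d`. [OURS · L1 W4.5a; folklore] -/
theorem minDeg_aeval (f : Letter → YPoly k) (hf : ∀ i, constantCoeff (f i) = 0) {G : YPoly k} {d : ℕ} (hG : MinDeg G d) :
    MinDeg (aeval f G) d := by
  classical
  rw [G.as_sum, map_sum]
  refine minDeg_sum _ _ fun e he => ?_
  rw [aeval_monomial, algebraMap_eq, Finsupp.prod]
  refine minDeg_C_mul (minDeg_mono (minDeg_prod _ _ (fun i => e i * 1) fun i _ => minDeg_pow (minDeg_one_of_constantCoeff (hf i)) _) ?_) _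
  simp only [mul_one]
  have hsum : ∑ i ∈ e.support, e i = tdeg e := by rw [tdeg_eq_sum, Finsupp.sum]
  rw [hsum]
  exact hG e he

/-- ★ SUBSTITUTIONS WITHOUT CONSTANT TERMS DO NOT LOWER ORDERS: `ord₀ (aeval f G) ≤ m ⇒ ord₀ G ≤ m`. [OURS · L1 W4.5a; folklore] -/
theorem ordLE_of_ordLE_aeval (f : Letter → YPoly k) (hf : ∀ i, constantCoeff (f i) = 0) {G : YPoly k} {m : ℕ}
    (h : OrdLE (aeval f G) m) : OrdLE G m := by
  by_contra hno
  have hG : MinDeg G (m + 1) := by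
    intro e he; by_contra hlt; exact hno ⟨e, he, by omega⟩
  obtain ⟨e, he, hem⟩ := h
  have := minDeg_aeval f hf hG e he
  omega

/-- The letters of `tri s a b` have no constant terms when `b(0) = 0`. [plumbing] -/
theorem constantCoeff_tri_letter (s : Letter) (a : YPoly k) {b : YPoly k} (hb : constantCoeff b = 0) (m : Letter) :
    constantCoeff ((fun m => if m = s then a * X s + b else X m) m : YPoly k) = 0 := by
  by_cases hm : m = s
  · simp only [hm, if_true, map_add, map_mul, constantCoeff_X, mul_zero, zero_add, hb]
  · simp only [hm, if_false, constantCoeff_X]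

/-- `ord₀ (tri s a b G) ≤ m ⇒ ord₀ G ≤ m` when `b(0) = 0`. [OURS · L1 W4.5a] -/
theorem ordLE_of_ordLE_tri (s : Letter) (a : YPoly k) {b : YPoly k} (hb : constantCoeff b = 0) {G : YPoly k} {m : ℕ}
    (h : OrdLE (tri s a b G) m) : OrdLE G m :=
  ordLE_of_ordLE_aeval _ (constantCoeff_tri_letter s a hb) h

/-- Any factor can be removed from an order bound: `ord₀ (U·H) ≤ m ⇒ ord₀ H ≤ m`. [plumbing] -/
theorem ordLE_of_mul {U H : YPoly k} {m : ℕ} (h : OrdLE (U * H) m) : OrdLE H m := by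
  classical
  obtain ⟨e, he, hem⟩ := h
  obtain ⟨e₁, -, e₂, he₂, rfl⟩ := Finset.mem_add.mp (support_mul U H he)
  refine ⟨e₂, he₂, ?_⟩
  rw [tdeg_add] at hem; omega

/-! ## 3. Divisibility by an exceptional letter passes back through `ψ` -/

/-- If no monomial of `G` is free of `y_n`, then `y_n ∣ G`. [plumbing; the `iff` is K10k `X_dvd_iff_forall_ne`] -/
theorem X_dvd_of_no_free {n : Letter} {G : YPoly k} (h : ∀ e ∈ G.support, e n ≠ 0) : (X n : YPoly k) ∣ G := by
  classical
  rw [X_dvd_iff_modMonomial_eq_zero]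
  ext e
  rw [coeff_zero]
  by_cases hle : Finsupp.single n 1 ≤ e
  · exact coeff_modMonomial_of_le _ hle
  · rw [coeff_modMonomial_of_not_le _ hle]
    by_contra hc
    exact hle (Finsupp.single_le_iff.mpr (Nat.one_le_iff_ne_zero.mpr (h e (MvPolynomial.mem_support_iff.mpr hc))))

/-- A monomial free of `y_n` witnesses `y_n ∤ G`. [plumbing] -/
theorem not_X_dvd_of_free {n : Letter} {G : YPoly k} {e : Expo} (he : e ∈ G.support) (hen : e n = 0) : ¬ (X n : YPoly k) ∣ G := by
  classical
  rintro ⟨Q, hQ⟩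
  have hc := MvPolynomial.mem_support_iff.mp he
  rw [hQ, coeff_X_mul', if_neg (by rw [Finsupp.mem_support_iff, hen]; exact fun h => h rfl)] at hc
  exact hc rfl

/-- `keep T` does not create letters. [plumbing] -/
theorem vars_keep_subset (T : Finset Letter) (G : YPoly k) : (keep T G).vars ⊆ G.vars := by
  intro i hi
  rw [mem_vars_iff_mem_support] at hi ⊢
  obtain ⟨d, hd, hid⟩ := hi
  exact ⟨d, (mem_support_of_keep hd).1, hid⟩

/-- `keep T` preserves the constant coefficient. [plumbing] -/
theorem constantCoeff_keep (T : Finset Letter) (G : YPoly k) : constantCoeff (keep T G) = constantCoeff G := by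
  rw [constantCoeff_eq, coeff_keep, if_pos (by rw [Finsupp.support_zero]; exact Finset.empty_subset T)]

/-- Killing `y_n` (`n ≠ s`) intertwines `tri s a b` with `tri s ā b̄`, `ā, b̄` the killed coefficients. [plumbing] -/
theorem keep_tri {s n : Letter} (hns : n ≠ s) (a b G : YPoly k) :
    keep (Finset.univ.erase n) (tri s a b G) = tri s (keep (Finset.univ.erase n) a) (keep (Finset.univ.erase n) b) (keep (Finset.univ.erase n) G) := by
  set T := Finset.univ.erase n with hT
  have h : (keep T).comp (tri s a b) = (tri s (keep T a) (keep T b)).comp (keep (k := k) T) := by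
    apply algHom_ext; intro m
    rw [AlgHom.comp_apply, AlgHom.comp_apply, keep_X]
    by_cases hms : m = s
    · subst hms
      have hmT : m ∈ T := by rw [hT]; exact Finset.mem_erase.mpr ⟨fun h => hns h.symm, Finset.mem_univ m⟩
      rw [tri_X_self, if_pos hmT, tri_X_self, map_add, map_mul, keep_X, if_pos hmT]
    · rw [tri_X_ne s a b hms]
      by_cases hmT : m ∈ T
      · rw [keep_X, if_pos hmT, tri_X_ne s _ _ hms]
      · rw [keep_X, if_neg hmT, map_zero]
  exact DFunLike.congr_fun h G

/-- ★ DIVISIBILITY BY A FIXED LETTER PASSES BACK THROUGH `ψ`: `n ≠ s`, `a(0) ≠ 0`, `a, b` free of `y_s`, then `y_n ∣ tri s a b G ⇒ y_n ∣ G` (kill `y_n`; the killed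
substitution is still triangular with non-zero `y_s`-coefficient, hence injective). [OURS · L1 W4.5a] -/
theorem X_dvd_of_X_dvd_tri {s n : Letter} (hns : n ≠ s) {a b : YPoly k} (ha : constantCoeff a ≠ 0) (hav : s ∉ a.vars) (hbv : s ∉ b.vars)
    {G : YPoly k} (h : (X n : YPoly k) ∣ tri s a b G) : (X n : YPoly k) ∣ G := by
  classical
  set T := Finset.univ.erase n with hT
  -- keep T kills multiples of y_n
  have hkill : keep T (tri s a b G) = 0 := by
    obtain ⟨Q, hQ⟩ := h
    rw [hQ, map_mul, keep_X, if_neg (by rw [hT]; exact Finset.notMem_erase n _), zero_mul]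
  rw [keep_tri hns] at hkill
  have hinj := tri_injective s (a := keep T a) (b := keep T b)
    (fun h0 => ha (by rw [← constantCoeff_keep T a, h0, map_zero]))
    (fun hm => hav (vars_keep_subset T a hm)) (fun hm => hbv (vars_keep_subset T b hm))
  have hG0 : keep T G = 0 := hinj (by rw [hkill, map_zero])
  refine X_dvd_of_no_free fun e he hen => ?_
  have hsub : e.support ⊆ T := by
    intro m hm
    rw [hT, Finset.mem_erase]
    exact ⟨fun h' => (Finsupp.mem_support_iff.mp hm) (h' ▸ hen), Finset.mem_univ m⟩
  exact keep_ne_zero he hsub hG0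

end Summit.ResolutionOfSingularities.ResolutionOfSingularities.Theorems.FInjectiveMacaulayfication.LastCentreTriSubst

end
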